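import Literature.MathematicalPhysics.QuantumFieldTheory.Balaban1983to89.B9RWSums346MixedFactorAtPins

/-!
# `Balaban1983to89.B9RWSums346MixedFactorAtPinsClosed` — [B9] (3.88)–(3.89) ∕ (3.46) ∕ Cor 3.6: rows 18's `FactorsL2Mixed37Dir` at the N06 certificate's pins,
# this seat's member-level theorem `B9RWSums346MixedFactorAtPins.factorsL2Mixed37Dir_memberY` WITH ITS FOUR EXISTENTIAL CONSTANTS NAMED (`MFac aFac BFac δFac`) —
# the closed terms the certificate's displayed numerics (`p.M₁`, `p.a₁`, `pM.θM`, `p.δ₀`) and its `NumericsWitness` are compared with — and the theorem restated AT THEM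

T. Bałaban, *Propagators for lattice gauge theories in a background field*, Commun. Math. Phys. **99** (1985) 389–434 [`Balaban1985BackgroundPropagators`, "B9"],
(3.88)–(3.89) p. 409, (3.46) p. 398, Cor 3.6 p. 408, (3.35) p. 396; T. Bałaban, *Propagators and renormalization transformations for lattice gauge theories. II*,
Commun. Math. Phys. **96** (1984) 223–250 [`Balaban1984PropagatorsII`], (2.39)–(2.44) pp. 229–230, (2.52)–(2.55) p. 232, Lemma 2.1 (2.61) p. 234.

statement-level skeleton of published theorems with citation tags; proofs where landed; nothing here is a claim about the Yang–Mills mass gap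

WHY THIS FILE (cell `pub-ymgap`, Track A node N06 [B9], rows 18; width seat `pub-ymgap-dag-n06-w7`, g1, 2026-08-28).  The pattern of this seat's g0 drills
`B9Eq346GradGpDivAtPinsL2Closed` ∕ `B9Eq346MixedLegAtPinsL2Closed` (asked for by the knit owner dag-n06-d for its numerics): `factorsL2Mixed37Dir_memberY` concludes
`∃ MF aF BF δF > 0, ∀ …`; a certificate edition that consumes it compares its displayed numerics with THESE constants, so they are named once here by `Classical.choose`
(`MFac aFac BFac δFac`, functions of `d ℓ b₀ b₁ M⋆ N c₀`), their signs recorded (`_pos`), and the theorem restated at them (★★★ `factorsL2Mixed37Dir_memberY_at`).  Nothing else.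

HONEST SCOPE.  Four `Classical.choose` definitions + one restatement; no analysis; nothing of [B9] asserted beyond the kernel-checked parent; COUNT-NEUTRAL; N06 NOT
discharged; K1⁹ NOT closed; nothing continuum ∕ OS ∕ mass gap ∕ Clay.  NEW file (definition lane: 4 `def`); nothing landed is modified.
-/

noncomputable section

namespace Literature.MathematicalPhysics.QuantumFieldTheory.Balaban1983to89.B9RWSums346MixedFactorAtPinsClosed

open Literature.MathematicalPhysics.QuantumFieldTheory.Balaban1983to89
open Node00 B6KLevelCensusIndexV1 B6Geom246MultiLevelBox B6MultiLevelTorusOperator B6GlobalChartV1 B9BackgroundsKLevelV1 B6Geom246MultiLevelTorus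
open Literature.MathematicalPhysics.QuantumFieldTheory.Balaban1983to89.B6Ineq2142KLevelV1 (lvl β)
open Literature.MathematicalPhysics.QuantumFieldTheory.Balaban1983to89.B6RandomWalk (Ineq261)
open Literature.MathematicalPhysics.QuantumFieldTheory.Balaban1983to89.B9Ineq349SiteComposite (cdSL cdsSL)
open Literature.MathematicalPhysics.QuantumFieldTheory.Balaban1983to89.B9CoReadingCoords (coordOpK)
open Literature.MathematicalPhysics.QuantumFieldTheory.Balaban1983to89.B9CoReadingCoordsS (XSK blkSK sIK)
open Literature.MathematicalPhysics.QuantumFieldTheory.Balaban1983to89.B9CoReadingCoordsTranspose (TrIdx trBasis)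
open Literature.MathematicalPhysics.QuantumFieldTheory.Balaban1983to89.B9Thm34Ext (toB6)
open Literature.MathematicalPhysics.QuantumFieldTheory.Balaban1983to89.B9PinMembersKLevelV1 (MemberY geo9Y bg9Y)
open Literature.MathematicalPhysics.QuantumFieldTheory.Balaban1983to89.B9Thm37Sum (mulOp)
open Literature.MathematicalPhysics.QuantumFieldTheory.Balaban1983to89.B9Thm37Glue (IsTransposePair)
open Literature.MathematicalPhysics.QuantumFieldTheory.Balaban1983to89.B9Thm37Whole (Ops StaticOK Sizes)
open Literature.MathematicalPhysics.QuantumFieldTheory.Balaban1983to89.B9Thm37WholeDir (DirLetters37 Identities₂)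
open Literature.MathematicalPhysics.QuantumFieldTheory.Balaban1983to89.B9Thm37KLetterDir (FactorsL2Mixed37Dir)
open Literature.MathematicalPhysics.QuantumFieldTheory.Balaban1983to89.B9RWSums346SecondDiffGp (DirOps37)
open Literature.MathematicalPhysics.QuantumFieldTheory.Balaban1983to89.B9RWSums343to347Whole (Facts347)
open Literature.MathematicalPhysics.QuantumFieldTheory.Balaban1983to89.B6Cover236MultiLevelBlocks (cubes)
open Literature.MathematicalPhysics.QuantumFieldTheory.Balaban1983to89.B9WalkLettersCoordsS (hWalkY gsqcoS)
open Literature.MathematicalPhysics.QuantumFieldTheory.Balaban1983to89.B9RWSums346MixedFactorAtPins (factorsL2Mixed37Dir_memberY)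
open scoped Matrix Matrix.Norms.L2Operator

variable (d ℓ : ℕ) (hd : 1 ≤ d + 1) (hL : Odd (ℓ + 1) ∧ 1 < ℓ + 1) (b₀ b₁ : ℝ) (Mstar N : ℕ) [NeZero N] (c₀ : ℝ) (hc₀ : 0 < c₀)

/-- **THE THRESHOLD `M_F` OF ROWS 18's MIXED FACTOR AT THE PINS, NAMED** (first existential constant of `factorsL2Mixed37Dir_memberY`). [cite: Balaban1985BackgroundPropagators, (3.89) p.409, Cor 3.6 p.408] -/
def MFac : ℝ := (factorsL2Mixed37Dir_memberY d ℓ hd hL b₀ b₁ Mstar N hc₀).choose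

/-- **THE SMALLNESS THRESHOLD `a_F` (`c₀·M·α₀ ≤ a_F`), NAMED** (second existential constant). [cite: Balaban1985BackgroundPropagators, (3.35) p.396, Cor 3.6 p.408] -/
def aFac : ℝ := (factorsL2Mixed37Dir_memberY d ℓ hd hL b₀ b₁ Mstar N hc₀).choose_spec.choose

/-- **THE LEGS' CONSTANT `B_F`, NAMED** (third existential constant; print's `O(1)` of (3.46) at `G′_□`). [cite: Balaban1985BackgroundPropagators, (3.46) p.398, Cor 3.6 p.408] -/
def BFac : ℝ := (factorsL2Mixed37Dir_memberY d ℓ hd hL b₀ b₁ Mstar N hc₀).choose_spec.choose_spec.choose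

/-- **THE LEGS' DECAY RATE `δ_F`, NAMED** (fourth existential constant) — the closed term the rate conditions `δ_L ≤ δ_F`, `p.δ₀ ≤ ρ′ ≤ (1−α₁)δ_L` refer to.
[cite: Balaban1985BackgroundPropagators, (3.46) p.398, Cor 3.6 p.408] -/
def δFac : ℝ := (factorsL2Mixed37Dir_memberY d ℓ hd hL b₀ b₁ Mstar N hc₀).choose_spec.choose_spec.choose_spec.choose

/-- The defining property of the four named constants (this seat's theorem, unpacked once). [cite: Balaban1985BackgroundPropagators, (3.89) p.409, bookkeeping] -/
private theorem specFac : 0 < MFac d ℓ hd hL b₀ b₁ Mstar N c₀ hc₀ ∧ 0 < aFac d ℓ hd hL b₀ b₁ Mstar N c₀ hc₀ ∧ 0 < BFac d ℓ hd hL b₀ b₁ Mstar N c₀ hc₀ ∧ 0 < δFac d ℓ hd hL b₀ b₁ Mstar N c₀ hc₀ ∧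
    ∀ {G : Subgroup (Matrix (Fin N) (Fin N) ℂ)ˣ} (_ : G ≤ B7Prop2Explicit.unitaryUnits (Matrix (Fin N) (Fin N) ℂ))
        (x : MemberY d ℓ hd hL b₀ b₁ Mstar), MFac d ℓ hd hL b₀ b₁ Mstar N c₀ hc₀ ≤ (geo9Y x).M → ∀ α₀ : ℝ, 0 < α₀ → c₀ * (geo9Y x).M * α₀ ≤ aFac d ℓ hd hL b₀ b₁ Mstar N c₀ hc₀ →
      ∀ (U : (bg9Y (Matrix (Fin N) (Fin N) ℂ) G x).Cfg), (bg9Y (Matrix (Fin N) (Fin N) ℂ) G x).Reg335 c₀ α₀ U →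
      ∀ {bI : FBondY x.toKIdx → IBondY x.toKIdx} (_ : ∀ f, lvl x.hN x.D x.hk (bI f) = (blkV1 x.hN x.D f).1.1)
        (_ : ∀ f, (geomT x.D).dist (β x.hN x.D x.hk (bI f)) (blkV1 x.hN x.D f) ≤ 1) (R₀ : ℝ) (H₀ : Prop) [Fintype (geo9Y x).Site] [DecidableEq (geo9Y x).Site]
        {Y : Type} [Fintype Y] (𝔬 : Ops (geo9Y x) (bg9Y (Matrix (Fin N) (Fin N) ℂ) G x) (XSK (TrIdx N) x.toKIdx) Y ↥(cubes x.toKIdx.D.toDomains))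
        (𝔡 : DirOps37 𝔬 (Fin (d + 1))) (𝔩 : DirLetters37 𝔬 (Fin (d + 1)))
        (_ : 𝔬.blk = blkSK x.toKIdx (sIK x.toKIdx bI)) (_ : ∀ c, 𝔬.h c = hWalkY x c)
        (_ : ∀ c, 𝔬.Gsq U c = gsqcoS x (trBasis N) (bg9Y (Matrix (Fin N) (Fin N) ℂ) G x) (fun U => U) (parSymY x.toKIdx) c U)
        (_ : ∀ ν, 𝔡.Dd U ν = (etaS x.toKIdx)⁻¹ • coordOpK (trBasis N) (fun _ : Fin (d + 1) => (cdSL x.toKIdx U ν).restrictScalars ℝ))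
        (_ : ∀ μ, 𝔡.Dsd U μ = (etaS x.toKIdx)⁻¹ • coordOpK (trBasis N) (fun _ : Fin (d + 1) => (cdsSL x.toKIdx U μ).restrictScalars ℝ))
        {ρ Nn N' Cℓ : ℝ} {κ : Sizes} (_ : StaticOK 𝔬 ρ Nn N' Cℓ κ) (_ : κ.Nonneg)
        {dF d₁ : ℕ} {δ α L₀ α₁ δL ρ' : ℝ} (_ : Facts347 (geo9Y x) R₀ H₀ dF δ α L₀) (_ : 0 ≤ α * δ)
        (_ : 0 < δL) (_ : δL ≤ δFac d ℓ hd hL b₀ b₁ Mstar N c₀ hc₀) (_ : Ineq261 d₁ (toB6 (geo9Y x) R₀ H₀) δL α₁) (_ : 0 ≤ ρ') (_ : ρ' ≤ (1 - α₁) * δL)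
        (_ : Identities₂ 𝔬 𝔡 𝔩 R₀ H₀ U) (_ : ∀ c ν, IsTransposePair (𝔩.P U c ν) (𝔩.Pt U c ν)) (_ : ∀ c, IsTransposePair (𝔬.Cop U c) (𝔬.Ct U c)),
        FactorsL2Mixed37Dir 𝔬 𝔡 𝔩 R₀ H₀
          (((Fintype.card (Fin (d + 1)) : ℝ) * ((Real.sqrt (κ.kP * κ.kPt * L₀ ^ |(1 : ℝ)|) * Real.exp ((α * δ / 2 + (α * δ + ρ')) * ρ)) * BFac d ℓ hd hL b₀ b₁ Mstar N c₀ hc₀) +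
              (Real.sqrt (κ.kC * κ.kCt * L₀ ^ |(2 : ℝ)|) * Real.exp ((α * δ / 2 + (α * δ + ρ')) * ρ)) * (BFac d ℓ hd hL b₀ b₁ Mstar N c₀ hc₀ * L₀)) * B6.c1 d₁ δL α₁) ρ' U :=
  (factorsL2Mixed37Dir_memberY d ℓ hd hL b₀ b₁ Mstar N hc₀).choose_spec.choose_spec.choose_spec.choose_spec

/-- `0 < MFac`. [cite: Balaban1985BackgroundPropagators, Cor 3.6 p.408, bookkeeping] -/
theorem MFac_pos : 0 < MFac d ℓ hd hL b₀ b₁ Mstar N c₀ hc₀ := (specFac d ℓ hd hL b₀ b₁ Mstar N c₀ hc₀).1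

/-- `0 < aFac`. [cite: Balaban1985BackgroundPropagators, Cor 3.6 p.408, bookkeeping] -/
theorem aFac_pos : 0 < aFac d ℓ hd hL b₀ b₁ Mstar N c₀ hc₀ := (specFac d ℓ hd hL b₀ b₁ Mstar N c₀ hc₀).2.1

/-- `0 < BFac`. [cite: Balaban1985BackgroundPropagators, Cor 3.6 p.408, bookkeeping] -/
theorem BFac_pos : 0 < BFac d ℓ hd hL b₀ b₁ Mstar N c₀ hc₀ := (specFac d ℓ hd hL b₀ b₁ Mstar N c₀ hc₀).2.2.1

/-- `0 < δFac`. [cite: Balaban1985BackgroundPropagators, Cor 3.6 p.408, bookkeeping] -/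
theorem δFac_pos : 0 < δFac d ℓ hd hL b₀ b₁ Mstar N c₀ hc₀ := (specFac d ℓ hd hL b₀ b₁ Mstar N c₀ hc₀).2.2.2.1

/-- ★★★ **ROWS 18's `FactorsL2Mixed37Dir` AT THE PINS, AT THE NAMED CONSTANTS** — `factorsL2Mixed37Dir_memberY` with `MF aF BF δF` replaced by the closed terms
`MFac aFac BFac δFac`: same prefix, same pins, same displayed data, same two letter transposes, same conclusion. [cite: Balaban1985BackgroundPropagators, (3.88)–(3.89) p.409, (3.46) p.398, Cor 3.6 p.408, (3.35) p.396; Balaban1984PropagatorsII, (2.39)–(2.44) pp.229–230, (2.52)–(2.55) p.232, Lemma 2.1 (2.61) p.234] -/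
theorem factorsL2Mixed37Dir_memberY_at :
    ∀ {G : Subgroup (Matrix (Fin N) (Fin N) ℂ)ˣ} (_ : G ≤ B7Prop2Explicit.unitaryUnits (Matrix (Fin N) (Fin N) ℂ))
        (x : MemberY d ℓ hd hL b₀ b₁ Mstar), MFac d ℓ hd hL b₀ b₁ Mstar N c₀ hc₀ ≤ (geo9Y x).M → ∀ α₀ : ℝ, 0 < α₀ → c₀ * (geo9Y x).M * α₀ ≤ aFac d ℓ hd hL b₀ b₁ Mstar N c₀ hc₀ →
      ∀ (U : (bg9Y (Matrix (Fin N) (Fin N) ℂ) G x).Cfg), (bg9Y (Matrix (Fin N) (Fin N) ℂ) G x).Reg335 c₀ α₀ U →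
      ∀ {bI : FBondY x.toKIdx → IBondY x.toKIdx} (_ : ∀ f, lvl x.hN x.D x.hk (bI f) = (blkV1 x.hN x.D f).1.1)
        (_ : ∀ f, (geomT x.D).dist (β x.hN x.D x.hk (bI f)) (blkV1 x.hN x.D f) ≤ 1) (R₀ : ℝ) (H₀ : Prop) [Fintype (geo9Y x).Site] [DecidableEq (geo9Y x).Site]
        {Y : Type} [Fintype Y] (𝔬 : Ops (geo9Y x) (bg9Y (Matrix (Fin N) (Fin N) ℂ) G x) (XSK (TrIdx N) x.toKIdx) Y ↥(cubes x.toKIdx.D.toDomains))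
        (𝔡 : DirOps37 𝔬 (Fin (d + 1))) (𝔩 : DirLetters37 𝔬 (Fin (d + 1)))
        (_ : 𝔬.blk = blkSK x.toKIdx (sIK x.toKIdx bI)) (_ : ∀ c, 𝔬.h c = hWalkY x c)
        (_ : ∀ c, 𝔬.Gsq U c = gsqcoS x (trBasis N) (bg9Y (Matrix (Fin N) (Fin N) ℂ) G x) (fun U => U) (parSymY x.toKIdx) c U)
        (_ : ∀ ν, 𝔡.Dd U ν = (etaS x.toKIdx)⁻¹ • coordOpK (trBasis N) (fun _ : Fin (d + 1) => (cdSL x.toKIdx U ν).restrictScalars ℝ))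
        (_ : ∀ μ, 𝔡.Dsd U μ = (etaS x.toKIdx)⁻¹ • coordOpK (trBasis N) (fun _ : Fin (d + 1) => (cdsSL x.toKIdx U μ).restrictScalars ℝ))
        {ρ Nn N' Cℓ : ℝ} {κ : Sizes} (_ : StaticOK 𝔬 ρ Nn N' Cℓ κ) (_ : κ.Nonneg)
        {dF d₁ : ℕ} {δ α L₀ α₁ δL ρ' : ℝ} (_ : Facts347 (geo9Y x) R₀ H₀ dF δ α L₀) (_ : 0 ≤ α * δ)
        (_ : 0 < δL) (_ : δL ≤ δFac d ℓ hd hL b₀ b₁ Mstar N c₀ hc₀) (_ : Ineq261 d₁ (toB6 (geo9Y x) R₀ H₀) δL α₁) (_ : 0 ≤ ρ') (_ : ρ' ≤ (1 - α₁) * δL)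
        (_ : Identities₂ 𝔬 𝔡 𝔩 R₀ H₀ U) (_ : ∀ c ν, IsTransposePair (𝔩.P U c ν) (𝔩.Pt U c ν)) (_ : ∀ c, IsTransposePair (𝔬.Cop U c) (𝔬.Ct U c)),
        FactorsL2Mixed37Dir 𝔬 𝔡 𝔩 R₀ H₀
          (((Fintype.card (Fin (d + 1)) : ℝ) * ((Real.sqrt (κ.kP * κ.kPt * L₀ ^ |(1 : ℝ)|) * Real.exp ((α * δ / 2 + (α * δ + ρ')) * ρ)) * BFac d ℓ hd hL b₀ b₁ Mstar N c₀ hc₀) +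
              (Real.sqrt (κ.kC * κ.kCt * L₀ ^ |(2 : ℝ)|) * Real.exp ((α * δ / 2 + (α * δ + ρ')) * ρ)) * (BFac d ℓ hd hL b₀ b₁ Mstar N c₀ hc₀ * L₀)) * B6.c1 d₁ δL α₁) ρ' U :=
  (specFac d ℓ hd hL b₀ b₁ Mstar N c₀ hc₀).2.2.2.2

end Literature.MathematicalPhysics.QuantumFieldTheory.Balaban1983to89.B9RWSums346MixedFactorAtPinsClosed

end
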